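import Summits.AtomisticToContinuum.BoseEinsteinCondensation.Theses.BECIntegerBlockRotor
import Summits.AtomisticToContinuum.BoseEinsteinCondensation.Theorems.BlockLatticeFSumKinematics
import Summits.AtomisticToContinuum.BoseEinsteinCondensation.Theorems.BECIntegerBlockRotorBlockModeCountingRiemannSum
import HarnessLib

/-!
# `BlockModeCounting` (stmt-AtomisticToContinuum-13597, route `BECIntegerBlockRotor`, support, rank 9)
# PROVED: `BlockInfraredBound → BlockCondensation → FamilyBEC`  (decomp-a2c · hand-1 g9)

Mode counting, the `d = 3` step of the Kennedy–Lieb–Shastry scheme at the block scale: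
(i) PARSEVAL on the `K³`-dimensional span of the block indicators — the tree theorem
`…Theses.BlockLatticeFSum.Kinematics.parseval_blockWaves_trialState`: `Σ_{q mod K} n(f_q) = Σ_B n(u_B)`;
(ii) the zero block wave is the constant mode on the cell, so `n(f_0) = condensateOccupation`
(inlined; cf. `…SMC.blockWave_zero_eq_constantMode`); (iii) the INFRARED BOUND `n(f_q) ≤ C/√ε(q)` (`q ≢ 0`) and the
`d = 3` Riemann-sum constant `Σ_{q ≠ 0} ε(q)^{-1/2} ≤ 2K³` (`sum_inv_sqrt_eps_le`) give
`Σ_{q ≠ 0} n(f_q) ≤ 2C K³`; (iv) inside the window `A/√ρ ≤ L/K`, `K³ ≤ N√ρ/A³ ≤ N/(8C)` once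
`√ρ ≤ A³/(8C)`, so `Σ_{q≠0} ≤ N/4`; with `η = 1/4` in `BlockCondensation` the zero mode keeps `≥ N/2`, and
`le_periodicCondensateNumber` turns the uniform bound over `δ`-near-minimisers into
`periodicCondensateNumber ≥ N/2`.  Hence `FamilyBEC` with the infrared bound's `A`, `c = 1/2`,
`ρ₀ = min ρ₀ᴵᴿ ρ₀ᴮᶜ (A³/(8C))²`, `N₀ = max N₀ᴵᴿ N₀ᴮᶜ 1`.
Main theorem: `blockModeCounting_proof : Theses.BECIntegerBlockRotor.BlockModeCounting`.  Imports only the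
Theses-free kinematics kit (`BlockLatticeFSumKinematics`) besides this route's file and the Riemann-sum helper
(theses-cone hygiene, critic row 420 (2)).  No definitions, no `sorry`.  [cite: KLS1988PRL, eqs. (5)–(8)] [cite: LSSY2005, Thm. 5.1]
-/

noncomputable section

open MeasureTheory Complex Filter Finset
open scoped ENNReal NNReal BigOperators Topology

namespace Summit.AtomisticToContinuum.BoseEinsteinCondensation.Theorems.BECIntegerBlockRotorBlockModeCounting

open Literature.MathematicalPhysics.QuantumManyBody.BoseGas
open Literature.Barriers.AtomisticToContinuum.BoseGas
open Summit.AtomisticToContinuum.BoseEinsteinCondensation.Theses.BlockLatticeFSum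

/-! ## Abstract bookkeeping -/

/-- Summing an infrared bound `n_q ≤ C/√ε_q` over a finite set against a Riemann-sum bound
`Σ 1/√ε_q ≤ B`. [folklore] -/
theorem sum_le_of_infrared {ι : Type*} (s : Finset ι) (n : ι → ℝ≥0∞) (ε : ι → ℝ) {C B : ℝ}
    (hC : 0 ≤ C) (hIR : ∀ q ∈ s, n q ≤ ENNReal.ofReal (C / Real.sqrt (ε q)))
    (hR : ∑ q ∈ s, 1 / Real.sqrt (ε q) ≤ B) :
    ∑ q ∈ s, n q ≤ ENNReal.ofReal (C * B) := by
  calc ∑ q ∈ s, n q ≤ ∑ q ∈ s, ENNReal.ofReal (C / Real.sqrt (ε q)) := Finset.sum_le_sum hIR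
    _ = ENNReal.ofReal (∑ q ∈ s, C / Real.sqrt (ε q)) :=
        (ENNReal.ofReal_sum_of_nonneg fun q _ => div_nonneg hC (Real.sqrt_nonneg _)).symm
    _ ≤ ENNReal.ofReal (C * B) := by
        refine ENNReal.ofReal_le_ofReal ?_
        have h : ∑ q ∈ s, C / Real.sqrt (ε q) = C * ∑ q ∈ s, 1 / Real.sqrt (ε q) := by
          rw [Finset.mul_sum]
          refine Finset.sum_congr rfl fun q _ => ?_
          rw [mul_one_div]
        rw [h]
        exact mul_le_mul_of_nonneg_left hR hC

/-- Mode counting in `ℝ≥0∞`: total mass `≥ (3/4)N` and non-zero-mode mass `≤ N/4` leave `≥ N/2` in the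
zero mode. [folklore] -/
theorem zero_mode_ge {ι : Type*} [Fintype ι] [DecidableEq ι] (n : ι → ℝ≥0∞) (q₀ : ι) {N : ℝ}
    (hN : 0 ≤ N) (hP : ENNReal.ofReal ((1 - 1 / 4) * N) ≤ ∑ q, n q)
    (hS : ∑ q ∈ univ.erase q₀, n q ≤ ENNReal.ofReal (N / 4)) :
    ENNReal.ofReal (1 / 2 * N) ≤ n q₀ := by
  rw [← Finset.add_sum_erase univ n (Finset.mem_univ q₀)] at hP
  have h1 : ENNReal.ofReal ((1 - 1 / 4) * N) = ENNReal.ofReal (1 / 2 * N) + ENNReal.ofReal (N / 4) := by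
    rw [← ENNReal.ofReal_add (by positivity) (by positivity)]
    congr 1; ring
  have h2 : ENNReal.ofReal (1 / 2 * N) + ENNReal.ofReal (N / 4) ≤ n q₀ + ENNReal.ofReal (N / 4) := by
    rw [← h1]
    exact hP.trans (add_le_add le_rfl hS)
  exact (ENNReal.add_le_add_iff_right ENNReal.ofReal_ne_top).1 h2

/-- Window arithmetic: `A/√ρ ≤ L/K` with `ρ = N/L³` gives `K³ ≤ N√ρ/A³`. [folklore] -/
theorem cube_le_of_window {A L ρ N : ℝ} {K : ℕ} (hA : 0 < A) (hρ : 0 < ρ) (hK : 0 < K)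
    (hNρ : N = ρ * L ^ 3) (hw : A / Real.sqrt ρ ≤ L / (K : ℝ)) :
    ((K : ℝ)) ^ 3 ≤ N * Real.sqrt ρ / A ^ 3 := by
  have hKr : (0 : ℝ) < K := by exact_mod_cast hK
  have hsr : 0 < Real.sqrt ρ := Real.sqrt_pos.2 hρ
  have h1 : A * (K : ℝ) ≤ L * Real.sqrt ρ := by
    rw [div_le_div_iff₀ hsr hKr] at hw; linarith
  have h2 : (A * (K : ℝ)) ^ 3 ≤ (L * Real.sqrt ρ) ^ 3 := pow_le_pow_left₀ (by positivity) h1 3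
  have h3 : (L * Real.sqrt ρ) ^ 3 = N * Real.sqrt ρ := by
    have hs3 : Real.sqrt ρ ^ 3 = ρ * Real.sqrt ρ := by rw [pow_succ, Real.sq_sqrt hρ.le]
    rw [mul_pow, hs3, hNρ]; ring
  rw [le_div_iff₀ (by positivity)]
  calc (K : ℝ) ^ 3 * A ^ 3 = (A * (K : ℝ)) ^ 3 := by ring
    _ ≤ N * Real.sqrt ρ := h2.trans_eq h3

/-! ## `BlockModeCounting` by name -/

/-- **`BlockModeCounting` (item stmt-AtomisticToContinuum-13597) PROVED**: the box-uniform infrared bound for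
block plane waves and the block floor (`BlockCondensation`, tree) imply BEC along the integer-filled family
(`FamilyBEC`) with `c = 1/2`, by Parseval on the block span, the `d = 3` Riemann-sum constant and the window
arithmetic. [cite: KLS1988PRL, eqs. (5)–(8)] -/
theorem blockModeCounting_proof : Theses.BECIntegerBlockRotor.BlockModeCounting := by
  intro hIR hBC v hv
  obtain ⟨ρI, hρI, A, hA, C, hC, NI, HIR⟩ := hIR v hv
  obtain ⟨ρB, hρB, NB, HBC⟩ := hBC v hv A hA (1 / 4) (by norm_num)
  obtain ⟨r, hr_def⟩ : ∃ r : ℝ, r = A ^ 3 / (8 * C) := ⟨_, rfl⟩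
  have hr : 0 < r := by rw [hr_def]; positivity
  refine ⟨A, hA, min ρI (min ρB (r ^ 2)), lt_min hρI (lt_min hρB (by positivity)), 1 / 2,
    by norm_num, max NI (max NB 1), fun N L hL hN hNL hK => ?_⟩
  obtain ⟨K, hKev, hK, hdvd, hw1, hw2⟩ := hK
  have hNI : NI ≤ N := le_trans (le_max_left _ _) hN
  have hNB : NB ≤ N := le_trans ((le_max_left _ _).trans (le_max_right _ _)) hN
  have hN1 : 1 ≤ N := le_trans ((le_max_right _ _).trans (le_max_right _ _)) hN
  have hNpos : 0 < N := hN1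
  have hNr : (0 : ℝ) < N := by exact_mod_cast hNpos
  have hL3 : 0 < L ^ 3 := by positivity
  -- the density of the box
  obtain ⟨ρ, hρ_def⟩ : ∃ ρ : ℝ, ρ = (N : ℝ) / L ^ 3 := ⟨_, rfl⟩
  rw [← hρ_def] at hw1 hw2
  have hρ : 0 < ρ := by rw [hρ_def]; positivity
  have hNρ : (N : ℝ) = ρ * L ^ 3 := by rw [hρ_def]; field_simp
  have hρle : ρ ≤ min ρI (min ρB (r ^ 2)) := by rw [hρ_def, div_le_iff₀ hL3]; exact hNL
  have hNLI : (N : ℝ) ≤ ρI * L ^ 3 := by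
    rw [hNρ]; exact mul_le_mul_of_nonneg_right (hρle.trans (min_le_left _ _)) hL3.le
  have hNLB : (N : ℝ) ≤ ρB * L ^ 3 := by
    rw [hNρ]
    exact mul_le_mul_of_nonneg_right (hρle.trans ((min_le_right _ _).trans (min_le_left _ _))) hL3.le
  have hρr : ρ ≤ r ^ 2 := hρle.trans ((min_le_right _ _).trans (min_le_right _ _))
  have hsr : Real.sqrt ρ ≤ r := by
    rw [← Real.sqrt_sq hr.le]; exact Real.sqrt_le_sqrt hρr
  -- the two `δ`'s
  obtain ⟨δ₁, hδ₁, H1⟩ := HIR N L hL hNI hNLI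
  obtain ⟨δ₂, hδ₂, H2⟩ := HBC N L hL hNB hNLB
  refine le_periodicCondensateNumber v (lt_min hδ₁ hδ₂) fun Ψ hΨ => ?_
  have hE1 : periodicEnergy v Ψ ≤ periodicGroundStateEnergy v N L + δ₁ :=
    hΨ.trans (add_le_add le_rfl (min_le_left _ _))
  have hE2 : periodicEnergy v Ψ ≤ periodicGroundStateEnergy v N L + δ₂ :=
    hΨ.trans (add_le_add le_rfl (min_le_right _ _))
  have hwin : A / Real.sqrt ρ ≤ L / (K : ℝ) ∧ L / (K : ℝ) ≤ 2 * A / Real.sqrt ρ := ⟨hw1, hw2⟩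
  have hwin' : A / Real.sqrt ((N : ℝ) / L ^ 3) ≤ L / (K : ℝ) ∧
      L / (K : ℝ) ≤ 2 * A / Real.sqrt ((N : ℝ) / L ^ 3) := by rw [← hρ_def]; exact hwin
  -- (i) the block floor at `η = 1/4`, read through Parseval
  have hP := H2 Ψ hE2 K hKev hK hwin'
  rw [← Kinematics.parseval_blockWaves_trialState hNpos hK hL Ψ] at hP
  -- (iii) the infrared bound on the non-zero block waves
  set q₀ : Fin 3 → Fin K := fun _ => (⟨0, hK⟩ : Fin K) with hq₀
  have hIRq : ∀ q ∈ (univ : Finset (Fin 3 → Fin K)).erase q₀,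
      cellOccupation N L (fun x : EuclideanSpace ℝ (Fin 3) => (((Real.sqrt (L ^ 3))⁻¹ : ℝ) : ℂ) *
        Complex.exp (((2 * Real.pi * (∑ j : Fin 3, ((q j : ℕ) : ℝ) * (⌊(K : ℝ) * x j / L⌋ : ℝ)) /
          (K : ℝ) : ℝ) : ℂ) * Complex.I)) Ψ.ψ ≤
      ENNReal.ofReal (C / Real.sqrt (∑ j : Fin 3, (1 - Real.cos (2 * Real.pi * ((q j : ℕ) : ℝ) / (K : ℝ))))) := by
    intro q hq
    rw [Finset.mem_erase] at hq
    have hnd : ¬ (∀ j : Fin 3, (K : ℤ) ∣ (((q j : ℕ) : ℤ))) := by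
      intro hall
      apply hq.1
      funext j
      have hdj : K ∣ (q j : ℕ) := by exact_mod_cast hall j
      exact Fin.ext (Nat.eq_zero_of_dvd_of_lt hdj (q j).isLt)
    have h := H1 Ψ hE1 K hKev hK hdvd hwin' (fun j => (((q j : ℕ) : ℤ))) hnd
    simp only [Int.cast_natCast] at h
    exact h
  have hS := sum_le_of_infrared ((univ : Finset (Fin 3 → Fin K)).erase q₀)
    (fun q : Fin 3 → Fin K => cellOccupation N L (fun x : EuclideanSpace ℝ (Fin 3) =>
      (((Real.sqrt (L ^ 3))⁻¹ : ℝ) : ℂ) * Complex.exp (((2 * Real.pi * (∑ j : Fin 3, ((q j : ℕ) : ℝ) *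
        (⌊(K : ℝ) * x j / L⌋ : ℝ)) / (K : ℝ) : ℝ) : ℂ) * Complex.I)) Ψ.ψ)
    (fun q : Fin 3 → Fin K => ∑ j : Fin 3, (1 - Real.cos (2 * Real.pi * ((q j : ℕ) : ℝ) / (K : ℝ))))
    hC.le hIRq (sum_inv_sqrt_eps_le hK)
  -- (iv) window arithmetic: `2 C K³ ≤ N/4`
  have hK3 : ((K : ℝ)) ^ 3 ≤ (N : ℝ) * Real.sqrt ρ / A ^ 3 := cube_le_of_window hA hρ hK hNρ hw1
  have hbud : C * (2 * (K : ℝ) ^ 3) ≤ (N : ℝ) / 4 := by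
    have h1 : (N : ℝ) * Real.sqrt ρ / A ^ 3 ≤ (N : ℝ) * r / A ^ 3 := by
      gcongr
    have h2 : C * ((N : ℝ) * r / A ^ 3) = (N : ℝ) / 8 := by
      rw [hr_def]; field_simp
    have h3 : C * (2 * (K : ℝ) ^ 3) ≤ 2 * (C * ((N : ℝ) * r / A ^ 3)) := by
      have := mul_le_mul_of_nonneg_left (hK3.trans h1) hC.le
      linarith
    rw [h2] at h3
    linarith
  have hS' : ∑ q ∈ (univ : Finset (Fin 3 → Fin K)).erase q₀,
      cellOccupation N L (fun x : EuclideanSpace ℝ (Fin 3) => (((Real.sqrt (L ^ 3))⁻¹ : ℝ) : ℂ) *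
        Complex.exp (((2 * Real.pi * (∑ j : Fin 3, ((q j : ℕ) : ℝ) * (⌊(K : ℝ) * x j / L⌋ : ℝ)) /
          (K : ℝ) : ℝ) : ℂ) * Complex.I)) Ψ.ψ ≤ ENNReal.ofReal ((N : ℝ) / 4) :=
    hS.trans (ENNReal.ofReal_le_ofReal hbud)
  -- (ii) the zero mode is the condensate mode; count
  have hcount := zero_mode_ge
    (fun q : Fin 3 → Fin K => cellOccupation N L (fun x : EuclideanSpace ℝ (Fin 3) =>
      (((Real.sqrt (L ^ 3))⁻¹ : ℝ) : ℂ) * Complex.exp (((2 * Real.pi * (∑ j : Fin 3, ((q j : ℕ) : ℝ) *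
        (⌊(K : ℝ) * x j / L⌋ : ℝ)) / (K : ℝ) : ℝ) : ℂ) * Complex.I)) Ψ.ψ)
    q₀ hNr.le hP hS'
  have h0 : cellOccupation N L (fun x : EuclideanSpace ℝ (Fin 3) => (((Real.sqrt (L ^ 3))⁻¹ : ℝ) : ℂ) *
      Complex.exp (((2 * Real.pi * (∑ j : Fin 3, (((q₀ j : Fin K) : ℕ) : ℝ) *
        (⌊(K : ℝ) * x j / L⌋ : ℝ)) / (K : ℝ) : ℝ) : ℂ) * Complex.I)) Ψ.ψ = condensateOccupation N L Ψ.ψ := by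
    have hzero : ∀ x ∈ cell L, (fun x : EuclideanSpace ℝ (Fin 3) => (((Real.sqrt (L ^ 3))⁻¹ : ℝ) : ℂ) *
        Complex.exp (((2 * Real.pi * (∑ j : Fin 3, (((q₀ j : Fin K) : ℕ) : ℝ) *
          (⌊(K : ℝ) * x j / L⌋ : ℝ)) / (K : ℝ) : ℝ) : ℂ) * Complex.I)) x = constantMode L x := by
      intro x hx
      simp [hq₀, constantMode, Set.indicator_of_mem hx, Complex.ofReal_inv]
    rw [Kinematics.cellOccupation_congr hzero]
    simp [cellOccupation, condensateOccupation, constantMode, Set.indicator_indicator]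
  rw [h0] at hcount
  exact hcount

end Summit.AtomisticToContinuum.BoseEinsteinCondensation.Theorems.BECIntegerBlockRotorBlockModeCounting

end
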